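import Summits.ResolutionOfSingularities.ResolutionOfSingularities.Theorems.WildQuotientsGaloisReductionPerfectSqueeze
import Summits.ResolutionOfSingularities.ResolutionOfSingularities.Theorems.WildQuotientsSummitReductionPerfectSqueeze
import Summits.ResolutionOfSingularities.ResolutionOfSingularities.Theorems.WildQuotientsGaloisQuotientAlterationDescentLemmas
import Summits.ResolutionOfSingularities.ResolutionOfSingularities.Theorems.PAlterationPicoverFunctionFieldRadicial
import Literature.AlgebraicGeometry.Motives.BaseChangeProofs
import HarnessLib

/-!
# WildQuotients / `GaloisQuotientAlteration` (stmt-ResolutionOfSingularities-16323): descent of a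
# Galois alteration datum from the perfect closure

Route `ResolutionOfSingularities/WildQuotients`, support item `GaloisQuotientAlteration`. The
staffed discharge of de Jong's theorem in this tree (crux `SummitReduction`, line `FramePerfect`)
produces the GALOIS ALTERATION DATUM (finite `G` acting on a regular integral PROJECTIVE `Y`,
`G`-invariant alteration `π`, `K(X) ⊂ K(Y)^G` purely inseparable) over PERFECT fields only; the
item quantifies over every field of characteristic `p`. `galoisAlterationDatum_of_perfectClosure`
is the missing descent: a projective datum of `X^∞ = (Spec K ×_k X)_red`, `K = k^{p^{-∞}}`,
descends to a datum of the projective `k`-variety `X` in the format consumed by the quotient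
construction `galoisQuotientAlterationAt_of_deJong`.

Proof: `n = |G|`; `G` acts `k`-rationally on `Q = (ℙᵐ_k)ⁿ ×_k X` by permuting the factors
(Cayley); `y ↦ ((ι ρ(gᵢ⁻¹) y)ᵢ, π y)` is a `G`-equivariant closed immersion `Y ↪ Spec K ×_k Q`;
the closed subscheme descends to a finitely generated, purely inseparable stage `k(t) ⊆ K`
(Görtz–Wedhorn I, Prop. 10.75: `exists_stage_model_of_closedImmersion`); `Y → Y_t` is
scheme-theoretically dominant, so the kernel of `Y_t ↪ Q_t` is `G`-stable and the action restricts;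
`Y_t` is integral and regular by flat descent (Matsumura 23.7); `Y_t → X` is a `G`-invariant
alteration (Zariski's Main Theorem near the generic point); (d) descends since `K(Y_t) → K(Y)` is
injective equivariant and `K(X) ⊂ K(X^∞)` is purely inseparable; finite subsets of `Y_t` lie in
affine boxes; faithfulness is free. Everything is proved; no named fact is used.
-/

noncomputable section

set_option linter.dupNamespace false -- mandated namespace of this single-conjunct summit

namespace Summit.ResolutionOfSingularities.ResolutionOfSingularities.Theorems

open CategoryTheory CategoryTheory.Limits AlgebraicGeometry TopologicalSpace Topology Opposite
open Literature.AlgebraicGeometry.Limits Literature.AlgebraicGeometry.Resolution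
open Literature.AlgebraicGeometry.RelativeSpec Literature.AlgebraicGeometry
open Literature.AlgebraicGeometry.Motives (RatFn.functionFieldMap RatFn.functionFieldMap_comp
  RatFn.genericPoint_eq_of_isDominant FunctionFieldOver FunctionFieldOver.of)
open Scheme.IdealSheafData

-- as in Mathlib's pullback API for schemes
set_option backward.isDefEq.respectTransparency false in
/-- **Descent of a projective Galois alteration datum from the perfect closure.** For an integral
projective `X` over a field `k` of characteristic `p`, `K = k^{p^{-∞}}` and
`X^∞ = (Spec K ×_k X)_red`: a Galois alteration datum of `X^∞` over `K` with PROJECTIVE regular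
source (`G` finite acting, `π` a `G`-invariant alteration, (d) on function fields) yields a Galois
alteration datum of `X` over `k` in the format of `DeJong1997_galoisAlterationQuasiProjective`
(faithful group, finite subsets in affine opens). Limit argument of EGA IV₃ §8 for an
equivariantly embedded `Y ↪ Spec K ×_k ((ℙᵐ_k)ⁿ ×_k X)`, flat descent of regularity.
[cite: GortzWedhorn2020, Prop. 10.75 (1), p. 333] [cite: DeJong1996, 4.5, p. 66] -/
theorem galoisAlterationDatum_of_perfectClosure (p : ℕ) [Fact p.Prime] {k : Type} [Field k]
    [CharP k p] {X : Scheme.{0}} [IsIntegral X] (f : X ⟶ Spec (.of k))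
    (hproj : Motives.IsProjectiveOver (Over.mk f))
    [IsIntegral (vanishingIdeal (⊤ : Closeds
      ↑(pullback (Spec.map (CommRingCat.ofHom (PerfectClosure.of k p))) f))).subscheme]
    (hK : ∃ (G : Type) (_ : Group G) (_ : Finite G) (Y : Scheme.{0}) (_ : IsIntegral Y)
      (ρ : G →* Aut Y)
      (π : Y ⟶ (vanishingIdeal (⊤ : Closeds
        ↑(pullback (Spec.map (CommRingCat.ofHom (PerfectClosure.of k p))) f))).subscheme)
      (_ : IsDominant π),
      IsAlteration π ∧ Scheme.IsRegular Y ∧ (∀ g : G, (ρ g).hom ≫ π = π) ∧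
      Motives.IsProjectiveOver (Over.mk (π ≫ (vanishingIdeal (⊤ : Closeds
        ↑(pullback (Spec.map (CommRingCat.ofHom (PerfectClosure.of k p))) f))).subschemeι ≫
          pullback.fst _ _) : Motives.SchemeOver (PerfectClosure k p)) ∧
      (∀ a : Y.functionField, (∀ g : G, RatFn.functionFieldMap (ρ g).hom a = a) →
        ∃ n : ℕ, a ^ ringExpChar ((vanishingIdeal (⊤ : Closeds
          ↑(pullback (Spec.map (CommRingCat.ofHom (PerfectClosure.of k p))) f))).subscheme).functionField ^ n ∈
          Set.range (RatFn.functionFieldMap π))) :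
    ∃ (G : Type) (_ : Group G) (_ : Finite G) (X₁ : Scheme.{0}) (_ : IsIntegral X₁)
      (ρ : G →* Aut X₁) (π : X₁ ⟶ X) (_ : IsDominant π),
      IsAlteration π ∧ Scheme.IsRegular X₁ ∧ Function.Injective ρ ∧
      (∀ g : G, (ρ g).hom ≫ π = π) ∧
      (∀ S : Finset X₁, ∃ U : X₁.Opens, IsAffineOpen U ∧ (↑S : Set X₁) ⊆ U) ∧
      (∀ a : X₁.functionField, (∀ g : G, RatFn.functionFieldMap (ρ g).hom a = a) →
        ∃ n : ℕ, a ^ ringExpChar X.functionField ^ n ∈ Set.range (RatFn.functionFieldMap π)) := by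
  classical
  obtain ⟨G, _, _, Y, _, ρ, π, _, hπ, hreg, hinv, hprojY, hd⟩ := hK
  have hp : p.Prime := Fact.out
  haveI : Fintype G := Fintype.ofFinite G
  letI : Algebra k (PerfectClosure k p) := (PerfectClosure.of k p).toAlgebra
  haveI := isAlgebraic_perfectClosure p k
  haveI : IsProper f := Motives.IsProjectiveOver.isProper hproj
  haveI := hπ.isProper
  -- ### notation over `K = k^{p^{-∞}}`
  let σK : CommRingCat.of k ⟶ CommRingCat.of (PerfectClosure k p) :=
    CommRingCat.ofHom (PerfectClosure.of k p)
  let XK := pullback (Spec.map σK) f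
  let Xinf := (vanishingIdeal (⊤ : Closeds ↑XK)).subscheme
  let ι₀ : Xinf ⟶ XK := (vanishingIdeal (⊤ : Closeds ↑XK)).subschemeι
  let πK : Y ⟶ Spec (.of (PerfectClosure k p)) := π ≫ ι₀ ≫ pullback.fst (Spec.map σK) f
  let πX : Y ⟶ X := π ≫ ι₀ ≫ pullback.snd (Spec.map σK) f
  have hπKX : πK ≫ Spec.map σK = πX ≫ f := by
    simp only [πK, πX, Category.assoc]
    rw [pullback.condition]
  have hρπK : ∀ h, (ρ h).hom ≫ πK = πK := fun h => by
    change (ρ h).hom ≫ π ≫ _ = _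
    rw [reassoc_of% (hinv h)]
  have hρπX : ∀ h, (ρ h).hom ≫ πX = πX := fun h => by
    change (ρ h).hom ≫ π ≫ _ = _
    rw [reassoc_of% (hinv h)]
  -- ### the projective embedding of `Y` over `K` and `ℙᵐ_K → ℙᵐ_k`
  obtain ⟨m, ιO, hιO⟩ := hprojY
  let PK := Motives.projectiveSpace m (PerfectClosure k p)
  let P := Motives.projectiveSpace m k
  let ιY : Y ⟶ PK.left := ιO.left
  haveI : IsClosedImmersion ιY := hιO
  have hιY : ιY ≫ PK.hom = πK := Over.w ιO
  -- ### `Q = (ℙᵐ_k)ⁿ ×_k X` with the permutation action; `ℙᵐ_K → ℙᵐ_k`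
  let pP : P.left ⟶ Spec (.of k) := P.hom
  haveI : IsProper pP := Motives.isProper_projectiveSpace m k
  let eBC := Motives.projectiveSpaceBaseChangeIso k (PerfectClosure k p) m
  haveI : IsIso eBC.hom.left := inferInstanceAs (IsIso ((Over.forget _).map eBC.hom))
  let β : PK.left ⟶ P.left := eBC.hom.left ≫ pullback.fst pP (Spec.map σK)
  have heBC : eBC.hom.left ≫ pullback.snd pP (Spec.map σK) = PK.hom := Over.w eBC.hom
  have hβ : β ≫ pP = PK.hom ≫ Spec.map σK := by
    simp only [β, Category.assoc]
    rw [pullback.condition, ← Category.assoc, heBC]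
  let n : ℕ := Fintype.card G
  let ε : G ≃ Fin n := Fintype.equivFin G
  let Pn := powOver pP n
  let bP : Pn ⟶ Spec (.of k) := powOver.base pP n
  let Q := pullback bP f
  let qP : Q ⟶ Pn := pullback.fst bP f
  let qX : Q ⟶ X := pullback.snd bP f
  haveI : IsProper qX := MorphismProperty.pullback_snd _ _ (inferInstance : IsProper bP)
  let QO : Over (Spec (.of k)) := Over.mk (qP ≫ bP)
  haveI : IsProper QO.hom := inferInstanceAs (IsProper (qP ≫ bP))
  let c : G →* Equiv.Perm (Fin n) := MonoidHom.mk'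
    (fun h => (ε.symm.trans (Equiv.mulLeft h)).trans ε) (fun h₁ h₂ => by ext i; simp)
  have hc_symm : ∀ h i, (c h).symm i = ε (h⁻¹ * ε.symm i) := fun h i => by
    change ((ε.symm.trans (Equiv.mulLeft h)).trans ε).symm i = _
    simp [Equiv.mulLeft_symm]
  let σQ : G → (Q ⟶ Q) := fun h => pullback.map bP f bP f (permHom pP n (c h)) (𝟙 X) (𝟙 _)
    (by rw [Category.comp_id, permHom_base]) (by simp)
  have σQ_fst : ∀ h, σQ h ≫ qP = qP ≫ permHom pP n (c h) := fun h => pullback.lift_fst _ _ _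
  have σQ_snd : ∀ h, σQ h ≫ qX = qX := fun h =>
    (pullback.lift_snd _ _ _).trans (Category.comp_id _)
  have σQ_hom : ∀ h, σQ h ≫ QO.hom = QO.hom := fun h => by
    change σQ h ≫ qP ≫ bP = qP ≫ bP
    rw [reassoc_of% (σQ_fst h), permHom_base]
  have σQ_one : σQ 1 = 𝟙 _ := by
    apply pullback.hom_ext
    · rw [σQ_fst, map_one, permHom_one, Category.id_comp, Category.comp_id]
    · rw [σQ_snd, Category.id_comp]
  have σQ_mul : ∀ h₁ h₂, σQ (h₁ * h₂) = σQ h₂ ≫ σQ h₁ := fun h₁ h₂ => by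
    apply pullback.hom_ext
    · rw [σQ_fst, map_mul, permHom_mul, Category.assoc, σQ_fst, reassoc_of% (σQ_fst h₂)]
    · rw [σQ_snd, Category.assoc, σQ_snd, σQ_snd]
  -- the action on the base changes `Spec R ×_k Q`
  let σB : ∀ (R : CommRingCat.{0}) (φ : CommRingCat.of k ⟶ R) (_ : G),
      pullback (Spec.map φ) QO.hom ⟶ pullback (Spec.map φ) QO.hom :=
    fun R φ h => pullback.map _ _ _ _ (𝟙 _) (σQ h) (𝟙 _) (by simp)
      (by rw [Category.comp_id, σQ_hom])
  have σB_fst : ∀ R φ h, σB R φ h ≫ pullback.fst _ _ = pullback.fst _ _ := fun R φ h =>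
    (pullback.lift_fst _ _ _).trans (Category.comp_id _)
  have σB_snd : ∀ R φ h, σB R φ h ≫ pullback.snd _ _ = pullback.snd _ _ ≫ σQ h :=
    fun R φ h => pullback.lift_snd _ _ _
  have σB_one : ∀ R φ, σB R φ 1 = 𝟙 _ := fun R φ => by
    apply pullback.hom_ext
    · rw [σB_fst, Category.id_comp]
    · rw [σB_snd, σQ_one, Category.id_comp, Category.comp_id]
  have σB_mul : ∀ R φ h₁ h₂, σB R φ (h₁ * h₂) = σB R φ h₂ ≫ σB R φ h₁ := fun R φ h₁ h₂ => by
    apply pullback.hom_ext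
    · rw [σB_fst, Category.assoc, σB_fst, σB_fst]
    · rw [σB_snd, σQ_mul, Category.assoc, σB_snd, reassoc_of% (σB_snd R φ h₂)]
  -- ### the equivariant closed embedding `Y ↪ Spec K ×_k Q`
  let crd : Fin n → (Y ⟶ P.left) := fun i => (ρ (ε.symm i)⁻¹).hom ≫ ιY ≫ β
  have hcrd : ∀ i, crd i ≫ pP = πX ≫ f := fun i => by
    change ((ρ _).hom ≫ ιY ≫ β) ≫ pP = _
    rw [Category.assoc, Category.assoc, hβ, reassoc_of% hιY, reassoc_of% (hρπK _)]
    exact hπKX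
  let M : Y ⟶ Pn := WidePullback.lift (πX ≫ f) crd fun i => hcrd i
  have hM_proj : ∀ i, M ≫ powOver.proj pP n i = crd i := fun i => WidePullback.lift_π _ _ _ _ _
  have hM_base : M ≫ bP = πX ≫ f := WidePullback.lift_base _ _ _ _
  let mQ : Y ⟶ Q := pullback.lift M πX hM_base
  have hmQ_fst : mQ ≫ qP = M := pullback.lift_fst _ _ _
  have hmQ_snd : mQ ≫ qX = πX := pullback.lift_snd _ _ _
  have hmQ_hom : mQ ≫ QO.hom = πX ≫ f := by
    change mQ ≫ qP ≫ bP = _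
    rw [reassoc_of% hmQ_fst, hM_base]
  let mK : Y ⟶ pullback (Spec.map σK) QO.hom := pullback.lift πK mQ (by rw [hπKX, hmQ_hom])
  have hmK_fst : mK ≫ pullback.fst _ _ = πK := pullback.lift_fst _ _ _
  have hmK_snd : mK ≫ pullback.snd _ _ = mQ := pullback.lift_snd _ _ _
  have hmQ_eq : ∀ h, (ρ h).hom ≫ mQ = mQ ≫ σQ h := fun h => by
    apply pullback.hom_ext
    · rw [Category.assoc, hmQ_fst, Category.assoc, σQ_fst, reassoc_of% hmQ_fst]
      apply WidePullback.hom_ext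
      · intro i
        rw [Category.assoc, hM_proj, Category.assoc, permHom_proj, hM_proj]
        change (ρ h).hom ≫ (ρ (ε.symm i)⁻¹).hom ≫ ιY ≫ β =
          (ρ (ε.symm ((c h).symm i))⁻¹).hom ≫ ιY ≫ β
        rw [hc_symm, Equiv.symm_apply_apply, ← Category.assoc, mul_inv_rev, inv_inv, map_mul,
          Aut.Aut_mul_def]
        rfl
      · simp only [Category.assoc]
        rw [show permHom pP n (c h) ≫ WidePullback.base (fun _ : Fin n => pP) = WidePullback.base _
            from permHom_base pP n (c h),
          show M ≫ WidePullback.base (fun _ : Fin n => pP) = πX ≫ f from hM_base,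
          reassoc_of% (hρπX h)]
    · rw [Category.assoc, hmQ_snd, Category.assoc, σQ_snd, hmQ_snd, hρπX]
  have hmK_eq : ∀ h, (ρ h).hom ≫ mK = mK ≫ σB _ σK h := fun h => by
    apply pullback.hom_ext
    · rw [Category.assoc, hmK_fst, hρπK, Category.assoc, σB_fst, hmK_fst]
    · rw [Category.assoc, hmK_snd, Category.assoc, σB_snd, reassoc_of% hmK_snd, hmQ_eq]
  -- `mK` is a closed immersion: followed by the projection to `Spec K ×_k ℙᵐ_k ≅ ℙᵐ_K` it is `ιY`
  let i₀ : Fin n := ε 1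
  let PK' := pullback (Spec.map σK) pP
  let θ : PK.left ⟶ PK' := eBC.hom.left ≫ (pullbackSymmetry pP (Spec.map σK)).hom
  have hθ_fst : θ ≫ pullback.fst _ _ = PK.hom := by
    simp only [θ, Category.assoc, pullbackSymmetry_hom_comp_fst]; exact heBC
  have hθ_snd : θ ≫ pullback.snd _ _ = β := by
    simp only [θ, β, Category.assoc, pullbackSymmetry_hom_comp_snd]
  let prK : pullback (Spec.map σK) QO.hom ⟶ PK' :=
    pullback.map (Spec.map σK) QO.hom (Spec.map σK) pP (𝟙 _) (qP ≫ powOver.proj pP n i₀) (𝟙 _)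
      (by simp) (by
        rw [Category.comp_id, Category.assoc]
        change qP ≫ bP = qP ≫ WidePullback.π (fun _ : Fin n => pP) i₀ ≫ pP
        rw [WidePullback.π_arrow])
  have hmK_prK : mK ≫ prK = ιY ≫ θ := by
    apply pullback.hom_ext
    · rw [Category.assoc, Category.assoc, hθ_fst, hιY]
      change mK ≫ pullback.map _ _ _ _ _ _ _ _ _ ≫ pullback.fst _ _ = πK
      rw [pullback.lift_fst, Category.comp_id, hmK_fst]
    · rw [Category.assoc, Category.assoc, hθ_snd]
      change mK ≫ pullback.map _ _ _ _ _ _ _ _ _ ≫ pullback.snd _ _ = ιY ≫ β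
      rw [pullback.lift_snd, reassoc_of% hmK_snd, reassoc_of% hmQ_fst, hM_proj]
      change (ρ (ε.symm (ε 1))⁻¹).hom ≫ ιY ≫ β = ιY ≫ β
      rw [Equiv.symm_apply_apply, inv_one, map_one]
      rfl
  haveI : IsClosedImmersion (mK ≫ prK) := by rw [hmK_prK]; infer_instance
  haveI : IsSeparated prK := by
    have h1 : prK ≫ pullback.fst _ _ = pullback.fst _ _ :=
      (pullback.lift_fst _ _ _).trans (Category.comp_id _)
    haveI : IsSeparated (prK ≫ pullback.fst (Spec.map σK) pP) := by rw [h1]; infer_instance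
    exact IsSeparated.of_comp prK (pullback.fst (Spec.map σK) pP)
  haveI : IsClosedImmersion mK := IsClosedImmersion.of_comp mK prK
  -- ### descent of the closed subscheme to a finite stage `k(t) ⊆ K`
  obtain ⟨t, Yt, ιt, e, hιt, Sq, he⟩ := exists_stage_model_of_closedImmersion QO mK
  let kt := FieldExt.fld k (PerfectClosure k p) t
  letI : Field kt := (FieldExt.isField_fld k (PerfectClosure k p) t).toField
  let ιn : k →+* kt := algebraMap k kt
  let ιL : kt →+* PerfectClosure k p := kt.val.toRingHom
  haveI : CharP kt p := (RingHom.charP_iff_charP ιL p).mpr inferInstance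
  let Qt := pullback (Spec.map (CommRingCat.ofHom ιn)) QO.hom
  let ιt' : Yt ⟶ Qt := ιt
  haveI : IsClosedImmersion ιt' := hιt
  have Sq' : IsPullback (mK ≫ pullback.fst _ _) e (Spec.map (CommRingCat.ofHom ιL))
      (ιt' ≫ pullback.fst _ _) := Sq
  have he' : e ≫ ιt' ≫ pullback.snd _ _ = mQ := he.trans hmK_snd
  -- `e : Y → Y_t` is flat, surjective, scheme-theoretically dominant
  haveI hflatL : Flat (Spec.map (CommRingCat.ofHom ιL)) := flat_specMap_of_field ιL
  haveI hsurjL : Surjective (Spec.map (CommRingCat.ofHom ιL)) := surjective_specMap_field ιL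
  haveI : Flat e := MorphismProperty.of_isPullback (P := @Flat) Sq' hflatL
  haveI : Surjective e := MorphismProperty.of_isPullback (P := @Surjective) Sq' hsurjL
  haveI : IsSchemeTheoreticallyDominant (Spec.map (CommRingCat.ofHom ιL)) :=
    IsSchemeTheoreticallyDominant.of_isDominant _
  haveI : Flat (ιt' ≫ pullback.fst (Spec.map (CommRingCat.ofHom ιn)) QO.hom) := flat_of_field _
  haveI : IsSchemeTheoreticallyDominant e := IsSchemeTheoreticallyDominant.of_isPullback Sq'
  have hker : ∀ {Z : Scheme.{0}} (ψ : Yt ⟶ Z), (e ≫ ψ).ker = ψ.ker := fun ψ => by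
    rw [Scheme.Hom.ker_comp, e.ker_eq_bot, Scheme.IdealSheafData.map_bot]
  -- equivariance at the stage: `ρ(h) ≫ e ≫ ιt = e ≫ ιt ≫ σ_t(h)`
  have het_fst : e ≫ ιt' ≫ pullback.fst _ _ = πK ≫ Spec.map (CommRingCat.ofHom ιL) := by
    rw [← Sq'.w, hmK_fst]
  have het_eq : ∀ h, (ρ h).hom ≫ e ≫ ιt' = e ≫ ιt' ≫ σB _ (CommRingCat.ofHom ιn) h := fun h => by
    apply pullback.hom_ext
    · simp only [Category.assoc, σB_fst]; rw [het_fst, reassoc_of% (hρπK h)]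
    · simp only [Category.assoc, σB_snd]; rw [reassoc_of% he', he']; exact hmQ_eq h
  -- the kernel of `ιt` is stable, so the action restricts to `Y_t`
  have hkerσ : ∀ h, ιt'.ker = (ιt' ≫ σB _ (CommRingCat.ofHom ιn) h).ker := fun h => by
    rw [← hker (ιt' ≫ σB _ _ h), ← het_eq h, Scheme.Hom.ker_comp_of_isIso, hker]
  let τ : G → (Yt ⟶ Yt) := fun h =>
    IsClosedImmersion.lift ιt' (ιt' ≫ σB _ (CommRingCat.ofHom ιn) h) (hkerσ h).le
  have hτ : ∀ h, τ h ≫ ιt' = ιt' ≫ σB _ (CommRingCat.ofHom ιn) h := fun h =>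
    IsClosedImmersion.lift_fac _ _ _
  have τ_one : τ 1 = 𝟙 _ := by
    rw [← cancel_mono ιt', hτ, σB_one, Category.id_comp, Category.comp_id]
  have τ_mul : ∀ h₁ h₂, τ (h₁ * h₂) = τ h₂ ≫ τ h₁ := fun h₁ h₂ => by
    rw [← cancel_mono ιt', hτ, σB_mul, Category.assoc, hτ, reassoc_of% (hτ h₂)]
  let ιτ : G → Aut Yt := fun h =>
    { hom := τ h
      inv := τ h⁻¹
      hom_inv_id := by rw [← τ_mul, inv_mul_cancel, τ_one]
      inv_hom_id := by rw [← τ_mul, mul_inv_cancel, τ_one] }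
  let ρt : G →* Aut Yt := MonoidHom.mk' ιτ fun h₁ h₂ => by ext : 1; exact τ_mul h₁ h₂
  have hρt : ∀ h, (ρt h).hom = τ h := fun _ => rfl
  have he_eq : ∀ h, (ρ h).hom ≫ e = e ≫ (ρt h).hom := fun h => by
    rw [hρt, ← cancel_mono ιt', Category.assoc, Category.assoc, hτ, het_eq]
  -- ### `Y_t` is integral and regular
  haveI : IsLocallyNoetherian Yt :=
    LocallyOfFiniteType.isLocallyNoetherian (ιt' ≫ pullback.fst (Spec.map (CommRingCat.ofHom ιn)) QO.hom)
  have hYtreg : Scheme.IsRegular Yt := isRegular_of_flat_surjective e hreg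
  haveI hYtint : IsIntegral Yt := isIntegral_of_flat_surjective e
  -- ### the `G`-invariant alteration `π_t : Y_t → X`
  let prn : Qt ⟶ Q := pullback.snd _ _
  have he'' : e ≫ ιt' ≫ prn = mQ := he'
  let πt : Yt ⟶ X := ιt' ≫ prn ≫ qX
  have heπt : e ≫ πt = πX := by
    change e ≫ ιt' ≫ prn ≫ qX = πX; rw [reassoc_of% he'', hmQ_snd]
  have hτπt : ∀ h, (ρt h).hom ≫ πt = πt := fun h => by
    rw [hρt]
    change τ h ≫ ιt' ≫ prn ≫ qX = ιt' ≫ prn ≫ qX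
    rw [reassoc_of% (hτ h), reassoc_of% (σB_snd _ (CommRingCat.ofHom ιn) h), σQ_snd]
  haveI : IsFinite (Spec.map (CommRingCat.ofHom ιn)) := isFinite_specMap_stage p k t
  haveI : IsFinite prn := MorphismProperty.pullback_snd _ _ inferInstance
  haveI : IsProper πt := inferInstance
  -- `π_X = π ≫ ι₀ ≫ pr_X` is dominant, hence so is `π_t`
  haveI hι₀surj : Surjective ι₀ := ⟨(isHomeomorph_subschemeι_vanishingIdeal_top).surjective⟩
  haveI : Surjective (Spec.map σK) := surjective_specMap_field (PerfectClosure.of k p)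
  haveI : Surjective (pullback.snd (Spec.map σK) f) := MorphismProperty.pullback_snd _ _ inferInstance
  haveI : IsDominant πX := inferInstance
  haveI : IsDominant (e ≫ πt) := by rw [heπt]; infer_instance
  haveI : IsDominant πt := IsDominant.of_comp e πt
  -- finiteness near the generic point: the generic fibre of `π_t` is the image of that of `π`
  haveI : UniversallyInjective (Spec.map σK) :=
    universallyInjective_specMap_field_of_pow_mem (PerfectClosure.of k p) p (perfectClosure_pow_mem p)
  haveI : UniversallyInjective (pullback.snd (Spec.map σK) f) := universallyInjective_pullback_snd _ _
  haveI : IsDominant (ι₀ ≫ pullback.snd (Spec.map σK) f) := inferInstance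
  haveI : UniversallyInjective (ι₀ ≫ pullback.snd (Spec.map σK) f) :=
    MorphismProperty.comp_mem _ _ _ (inferInstance : UniversallyInjective ι₀) inferInstance
  have hfib : (πt.base ⁻¹' {genericPoint X}).Finite := by
    obtain ⟨U, hUne, hUfin⟩ := hπ.exists_isFinite
    haveI := hUfin
    have hξU : genericPoint Xinf ∈ U :=
      ((genericPoint_spec Xinf).mem_open_set_iff U.isOpen).mpr (by simpa using hUne)
    have h1 : (π.base ⁻¹' {genericPoint Xinf}).Finite :=
      finite_preimage_singleton_of_isFinite_morphismRestrict π U hξU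
    have h2 : πX.base ⁻¹' {genericPoint X} ⊆ π.base ⁻¹' {genericPoint Xinf} := by
      intro y hy
      have hy' : (ι₀ ≫ pullback.snd (Spec.map σK) f).base (π.base y) = genericPoint X := hy
      have hgen : (ι₀ ≫ pullback.snd (Spec.map σK) f).base (genericPoint Xinf) = genericPoint X :=
        RatFn.genericPoint_eq_of_isDominant _
      have hinj : Function.Injective (ι₀ ≫ pullback.snd (Spec.map σK) f).base := by
        rw [Scheme.Hom.comp_base, TopCat.coe_comp]
        exact (pullback.snd (Spec.map σK) f).injective.comp ι₀.isClosedEmbedding.injective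
      exact hinj (hy'.trans hgen.symm)
    have h3 : πt.base ⁻¹' {genericPoint X} ⊆ e.base '' (πX.base ⁻¹' {genericPoint X}) := by
      intro z hz
      obtain ⟨y, rfl⟩ := e.surjective z
      refine ⟨y, ?_, rfl⟩
      change (e ≫ πt).base y ∈ ({genericPoint X} : Set X) at hz
      rwa [heπt] at hz
    exact ((h1.subset h2).image _).subset h3
  obtain ⟨V, hV, hVfin⟩ := exists_isFinite_morphismRestrict_of_finite_preimage_singleton
    (f := πt) (genericPoint X) hfib
  have hπt : IsAlteration πt := ⟨hYtint, inferInstance, inferInstance, V, ⟨_, hV⟩, hVfin⟩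
  -- ### finite subsets of `Y_t` lie in affine opens
  have hPproj : Motives.IsProjectiveOver (Over.mk pP : Motives.SchemeOver k) :=
    ⟨m, Over.homMk (𝟙 _) (Category.id_comp _), inferInstanceAs (IsClosedImmersion (𝟙 _))⟩
  have hAF_Pn := finsetAffine_powOver pP n (finset_subset_affineOpen_of_isProjectiveOver pP hPproj)
  have hAF_Q := finsetAffine_pullback bP f hAF_Pn (finset_subset_affineOpen_of_isProjectiveOver f hproj)
  haveI : IsAffineHom prn := MorphismProperty.pullback_snd _ _ inferInstance
  have hAF_Yt := finsetAffine_of_isAffineHom ιt' (finsetAffine_of_isAffineHom prn hAF_Q)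
  -- ### condition (d) at the stage
  haveI : CharP X.functionField p := charP_functionField_of_over f
  haveI : CharP Xinf.functionField p :=
    charP_functionField_of_over (ι₀ ≫ pullback.fst (Spec.map σK) f)
  haveI : ExpChar X.functionField p := ExpChar.prime hp
  haveI : ExpChar Xinf.functionField p := ExpChar.prime hp
  have hqX : ringExpChar X.functionField = p := ringExpChar.eq _ p
  have hqinf : ringExpChar Xinf.functionField = p := ringExpChar.eq _ p
  haveI hPI := Picover.FunctionFieldRadicial.stub_functionFieldRadicial Xinf X
    (ι₀ ≫ pullback.snd (Spec.map σK) f)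
  have hdt : ∀ a : Yt.functionField, (∀ g : G, RatFn.functionFieldMap (ρt g).hom a = a) →
      ∃ n : ℕ, a ^ ringExpChar X.functionField ^ n ∈ Set.range (RatFn.functionFieldMap πt) := by
    intro a ha
    have ha' : ∀ h, RatFn.functionFieldMap (ρ h).hom (RatFn.functionFieldMap e a) =
        RatFn.functionFieldMap e a :=
      functionFieldMap_apply_eq_of_equivariant e ρ ρt he_eq a ha
    obtain ⟨n₁, b, hb⟩ := hd _ ha'
    obtain ⟨n₂, c', hc'⟩ := IsPurelyInseparable.pow_mem X.functionField p
      (FunctionFieldOver.of (ι₀ ≫ pullback.snd (Spec.map σK) f) b)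
    refine ⟨n₁ + n₂, c', ?_⟩
    apply (RatFn.functionFieldMap e).injective
    -- `e♯ (π_t♯ c') = π_X♯ c' = π♯ ((ι₀ ≫ pr_X)♯ c')`
    have h1 : RatFn.functionFieldMap e (RatFn.functionFieldMap πt c') = RatFn.functionFieldMap πX c' := by
      have hc : RatFn.functionFieldMap (e ≫ πt) c' =
          RatFn.functionFieldMap e (RatFn.functionFieldMap πt c') := by
        rw [RatFn.functionFieldMap_comp πt e]; rfl
      rw [← hc]
      simp only [heπt]
    have h2 : RatFn.functionFieldMap πX c' =
        RatFn.functionFieldMap π (RatFn.functionFieldMap (ι₀ ≫ pullback.snd (Spec.map σK) f) c') := by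
      change RatFn.functionFieldMap (π ≫ ι₀ ≫ pullback.snd (Spec.map σK) f) c' = _
      rw [RatFn.functionFieldMap_comp (ι₀ ≫ pullback.snd (Spec.map σK) f) π]; rfl
    have h3 : RatFn.functionFieldMap (ι₀ ≫ pullback.snd (Spec.map σK) f) c' =
        b ^ p ^ n₂ := hc'
    rw [h1, h2, h3, map_pow, hb, hqinf, hqX, map_pow, ← pow_mul, ← pow_add]
  -- ### conclusion (faithfulness is free)
  exact galoisAlterationDatum_faithful ⟨G, inferInstance, inferInstance, Yt, hYtint, ρt, πt,
    inferInstance, hπt, hYtreg, hτπt, hAF_Yt, hdt⟩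

end Summit.ResolutionOfSingularities.ResolutionOfSingularities.Theorems

end
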